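import Summits.CriticalPhenomena.SAWScalingLimit.Theorems.ShellCrossingBound.Negative.Forcing5Endpoints

/-!
# `ShellCrossingBound` — negative knowledge: forcing corridors (the uniform-threshold Aizenman–Burchard hypothesis is false for the critical SAW)

Part 6: numerics of the forcing shell (`ρ ≤ (11k+2)/(2L+1)²`, `R ≥ 1/(2L+1)`, aspect ratio `< ε`) and the forcing theorem (`forcing`): every SAW of `Ω_δ` from `a_δ` to `b_δ` traverses the shell `k` times.

Support file for crux `stmt-CriticalPhenomena-4728` (refuter `cdisprove`; work file
`Summits/CriticalPhenomena/SAWScalingLimit/Cruxes/ShellCrossingBound/Disproof.lean`; conclusion in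
`Negative/UniformThresholdFalse.lean`). Everything proved. [folklore]
-/

noncomputable section

open Set Filter Topology Metric MeasureTheory Complex
open scoped ENNReal Real
open Literature.Probability.RandomPlanarGeometry Literature.Probability.LatticeModels

namespace Summit.CriticalPhenomena.SAWScalingLimit.Theorems.ShellCrossingBound.Negative.Forcing

/-! ## F.3 Numerics of the forcing shell -/

/-- `√a − √b ≤ √(a − b)` for `0 ≤ b ≤ a`. [folklore] -/
theorem sqrt_sub_sqrt_le {a b : ℝ} (hb : 0 ≤ b) (hab : b ≤ a) :
    Real.sqrt a - Real.sqrt b ≤ Real.sqrt (a - b) := by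
  have h1 : 0 ≤ Real.sqrt b := Real.sqrt_nonneg _
  have h2 : 0 ≤ Real.sqrt (a - b) := Real.sqrt_nonneg _
  have hsq : a ≤ (Real.sqrt b + Real.sqrt (a - b)) ^ 2 := by
    have hb2 := Real.sq_sqrt hb
    have hab2 := Real.sq_sqrt (sub_nonneg.2 hab)
    nlinarith [mul_nonneg h1 h2]
  have := Real.sqrt_le_sqrt hsq
  rw [Real.sqrt_sq (by positivity)] at this
  linarith

/-- Inner abscissa `u₀`, outer abscissa `u_top`, shell radii. [folklore] -/
def u0 (k L : ℕ) : ℝ := useq k L 0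
/-- Outer crossing abscissa `u_top = u_{2k}`. [folklore] -/
def utop (k L : ℕ) : ℝ := useq k L (2 * k)
/-- Outer radius of the forcing shell, `√u₀`. [folklore] -/
def Rsh (k L : ℕ) : ℝ := Real.sqrt (u0 k L)
/-- Inner radius of the forcing shell. [folklore] -/
def ρsh (k L : ℕ) : ℝ := (utop k L - u0 k L) + (Real.sqrt (utop k L) - Real.sqrt (u0 k L)) + sl * utop k L
/-- Shell centre: the bottom turning point above `u₀`. [folklore] -/
def xS (k L : ℕ) : ℂ := ⟨u0 k L, -Real.sqrt (u0 k L)⟩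

section Numerics

variable {k L : ℕ} (hL : 11 * k + 3 ≤ L)
include hL

/-- `2L + 1 ≥ 22k + 7`. [folklore] -/
theorem A_ge : (22 * k + 7 : ℝ) ≤ 2 * L + 1 := by
  have : ((11 * k + 3 : ℕ) : ℝ) ≤ L := by exact_mod_cast hL
  push_cast at this; linarith

omit hL in
/-- `2L + 1 > 0`. [folklore] -/
theorem A_pos : (0 : ℝ) < 2 * L + 1 := by positivity

omit hL in
/-- Formula for `u₀`. [folklore] -/
theorem u0_eq : u0 k L = 2 / ((2 * L + 1 : ℝ) ^ 2 + 4 * k) := useq_zero k L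

omit hL in
/-- Formula for `u_top`. [folklore] -/
theorem utop_eq : utop k L = 2 / (2 * L + 1 : ℝ) ^ 2 := useq_top k L

omit hL in
/-- `u₀ > 0`. [folklore] -/
theorem u0_pos : 0 < u0 k L := useq_pos k L (Nat.zero_le _)

omit hL in
/-- `u_top > 0`. [folklore] -/
theorem utop_pos : 0 < utop k L := useq_pos k L le_rfl

omit hL in
/-- `u₀ ≤ u_top`. [folklore] -/
theorem u0_le_utop : u0 k L ≤ utop k L := useq_mono k L (Nat.zero_le _) le_rfl

/-- `u_top ≤ 2/49`. [folklore] -/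
theorem utop_le : utop k L ≤ 2 / 49 := by
  rw [utop_eq]
  have hA := A_ge hL
  have hk : (0 : ℝ) ≤ k := Nat.cast_nonneg k
  apply div_le_div_of_nonneg_left two_pos.le (by norm_num)
  nlinarith

/-- `u₀ ≤ 1`. [folklore] -/
theorem u0_le_one : u0 k L ≤ 1 := by
  have := u0_le_utop (k := k) (L := L); have := utop_le hL; linarith

/-- The outer radius is at least `1/(2L+1)`. [folklore] -/
theorem inv_A_le_R : 1 / (2 * L + 1 : ℝ) ≤ Rsh k L := by
  have hA := A_ge hL
  have hApos : (0 : ℝ) < 2 * L + 1 := A_pos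
  have hk : (0 : ℝ) ≤ k := Nat.cast_nonneg k
  have h1 : (1 / (2 * L + 1 : ℝ)) ^ 2 ≤ u0 k L := by
    rw [u0_eq, div_pow, one_pow, div_le_div_iff₀ (by positivity) (by positivity)]
    nlinarith
  have := Real.sqrt_le_sqrt h1
  rwa [Real.sqrt_sq (by positivity)] at this

/-- The outer radius is at most `1`. [folklore] -/
theorem R_le_one : Rsh k L ≤ 1 :=
  Real.sqrt_le_one.2 (u0_le_one hL)    -- may need adjusting

omit hL in
/-- The window width is at most `8k/(2L+1)⁴`. [folklore] -/
theorem utop_sub_u0_le : utop k L - u0 k L ≤ 8 * k / (2 * L + 1 : ℝ) ^ 4 := by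
  have hApos : (0 : ℝ) < 2 * L + 1 := A_pos
  have hk : (0 : ℝ) ≤ k := Nat.cast_nonneg k
  have hden : (0 : ℝ) < (2 * L + 1) ^ 2 + 4 * k := by positivity
  have heq : utop k L - u0 k L = 8 * k / ((2 * L + 1 : ℝ) ^ 2 * ((2 * L + 1) ^ 2 + 4 * k)) := by
    rw [utop_eq, u0_eq]
    field_simp
    ring
  rw [heq]
  apply div_le_div_of_nonneg_left (by positivity) (by positivity)
  nlinarith [sq_nonneg ((2 * L + 1 : ℝ) ^ 2)]

omit hL in
/-- `√u_top − √u₀ ≤ (3k+1)/(2L+1)²`. [folklore] -/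
theorem sqrt_utop_sub_le : Real.sqrt (utop k L) - Real.sqrt (u0 k L) ≤ (3 * k + 1) / (2 * L + 1 : ℝ) ^ 2 := by
  have hApos : (0 : ℝ) < 2 * L + 1 := A_pos
  have hk : (0 : ℝ) ≤ k := Nat.cast_nonneg k
  refine (sqrt_sub_sqrt_le (u0_pos).le u0_le_utop).trans ?_
  refine (Real.sqrt_le_sqrt (utop_sub_u0_le (k := k) (L := L))).trans ?_
  have h4 : (2 * L + 1 : ℝ) ^ 4 = ((2 * L + 1) ^ 2) ^ 2 := by ring
  rw [h4, Real.sqrt_div' _ (by positivity), Real.sqrt_sq (by positivity)]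
  apply div_le_div_of_nonneg_right _ (by positivity)
  have h8 : (8 * k : ℝ) ≤ (3 * k + 1) ^ 2 := by nlinarith [sq_nonneg ((k : ℝ) - 1), sq_nonneg (k : ℝ)]
  have := Real.sqrt_le_sqrt h8
  rwa [Real.sqrt_sq (by positivity)] at this

/-- The inner radius is at most `(11k+2)/(2L+1)²`. [folklore] -/
theorem ρ_le : ρsh k L ≤ (11 * k + 2) / (2 * L + 1 : ℝ) ^ 2 := by
  have hA := A_ge hL
  have hApos : (0 : ℝ) < 2 * L + 1 := A_pos
  have hk : (0 : ℝ) ≤ k := Nat.cast_nonneg k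
  have h1 := utop_sub_u0_le (k := k) (L := L)
  have h2 := sqrt_utop_sub_le (k := k) (L := L)
  have h3 : sl * utop k L = (1 / 2) / (2 * L + 1 : ℝ) ^ 2 := by
    rw [utop_eq, sl]; field_simp; ring
  have h1' : 8 * k / (2 * L + 1 : ℝ) ^ 4 ≤ 8 * k / (2 * L + 1 : ℝ) ^ 2 := by
    apply div_le_div_of_nonneg_left (by positivity) (by positivity)
    have hA1 : (1 : ℝ) ≤ 2 * L + 1 := by linarith
    exact pow_le_pow_right₀ hA1 (by norm_num)
  unfold ρsh
  rw [h3]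
  have hsum : 8 * k / (2 * L + 1 : ℝ) ^ 2 + (3 * k + 1) / (2 * L + 1 : ℝ) ^ 2 + (1 / 2) / (2 * L + 1 : ℝ) ^ 2
      ≤ (11 * k + 2) / (2 * L + 1 : ℝ) ^ 2 := by
    rw [← add_div, ← add_div]
    apply div_le_div_of_nonneg_right _ (by positivity)
    linarith
  linarith

omit hL in
/-- The inner radius is positive. [folklore] -/
theorem ρ_pos : 0 < ρsh k L := by
  have h1 := u0_le_utop (k := k) (L := L)
  have h2 : Real.sqrt (u0 k L) ≤ Real.sqrt (utop k L) := Real.sqrt_le_sqrt h1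
  have h3 : 0 < sl * utop k L := mul_pos sl_pos utop_pos
  unfold ρsh; linarith

/-- The forcing shell is genuine: `ρ < R`. [folklore] -/
theorem ρ_lt_R : ρsh k L < Rsh k L := by
  have hA := A_ge hL
  have hApos : (0 : ℝ) < 2 * L + 1 := A_pos
  have hk : (0 : ℝ) ≤ k := Nat.cast_nonneg k
  refine (ρ_le hL).trans_lt (lt_of_lt_of_le ?_ (inv_A_le_R hL))
  rw [div_lt_div_iff₀ (by positivity) hApos]
  nlinarith

/-- The wedge half-width at the window is below the outer radius. [folklore] -/
theorem sl_utop_le_R : sl * utop k L ≤ Rsh k L := by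
  have hA := A_ge hL
  have hApos : (0 : ℝ) < 2 * L + 1 := A_pos
  have hk : (0 : ℝ) ≤ k := Nat.cast_nonneg k
  refine le_trans ?_ (inv_A_le_R hL)
  rw [utop_eq, sl, mul_div_assoc', div_le_div_iff₀ (by positivity) hApos]
  nlinarith

/-- The aspect ratio of the forcing shell is below `ε`. [folklore] -/
theorem ratio_lt {ε : ℝ} (hε : 0 < ε) (hLε : (11 * k + 3) / ε ≤ L) : ρsh k L / Rsh k L < ε := by
  have hA := A_ge hL
  have hApos : (0 : ℝ) < 2 * L + 1 := A_pos
  have hk : (0 : ℝ) ≤ k := Nat.cast_nonneg k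
  have hR : 0 < Rsh k L := lt_of_lt_of_le (by positivity) (inv_A_le_R hL)
  have h1 : ρsh k L / Rsh k L ≤ ((11 * k + 2) / (2 * L + 1 : ℝ) ^ 2) / (1 / (2 * L + 1 : ℝ)) :=
    div_le_div₀ (by positivity) (ρ_le hL) (by positivity) (inv_A_le_R hL)
  have h2 : ((11 * k + 2) / (2 * L + 1 : ℝ) ^ 2) / (1 / (2 * L + 1 : ℝ)) = (11 * k + 2) / (2 * L + 1) := by
    field_simp
  rw [h2] at h1
  refine h1.trans_lt ?_
  rw [div_lt_iff₀ hApos]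
  rw [div_le_iff₀ hε] at hLε
  nlinarith

end Numerics


/-! ## F.4 The forcing theorem -/

/-- The SAW polyline stays in the closure of the carrier. [folklore] -/
theorem range_polyline_subset_closure {δ : ℝ} {a b : Site 2}
    (ha : a ∈ meshVertices forcingDomain.carrier δ) (γ : SAW.DomainSAW forcingDomain.carrier δ a b) :
    Set.range (γ.walk.toCurve (meshPoint δ)) ⊆ closure forcingDomain.carrier := by
  refine range_toCurve_subset (meshPoint δ) (fun x y hxy => ?_) γ.walk (subset_closure ha)
  exact (meshGraph_adj_iff.1 (discreteDomainGraph_adj_iff.1 hxy).1).2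

/-- `‖z‖ ≤ |re z| + |im z|` in difference form. [folklore] -/
theorem dist_le_abs_re_add_abs_im (z w : ℂ) : dist z w ≤ |z.re - w.re| + |z.im - w.im| := by
  rw [Complex.dist_eq]
  have := Complex.norm_le_abs_re_add_abs_im (z - w)
  simpa using this

/-- The difference of ordinates is bounded by the distance. [folklore] -/
theorem abs_im_sub_le_dist (z w : ℂ) : |z.im - w.im| ≤ dist z w := by
  rw [Complex.dist_eq]
  have := Complex.abs_im_le_norm (z - w)
  simpa using this

/-- **Forcing**: for every `k` and `ε > 0` a shell of aspect ratio `< ε` which, for all small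
meshes, EVERY self-avoiding walk of `Ω_δ` from `a_δ` to `b_δ` traverses `k` times (and the SAW law
is a probability measure). [folklore] -/
theorem forcing (k : ℕ) {ε : ℝ} (hε : 0 < ε) :
    ∃ (x : ℂ) (ρ R δ₁ : ℝ), 0 < δ₁ ∧ δ₁ ≤ ρ ∧ ρ < R ∧ R ≤ 1 ∧ ρ / R < ε ∧
      ∀ δ ∈ Set.Ioc (0 : ℝ) δ₁,
        IsProbabilityMeasure (SAW.law forcingDomain.carrier δ (aδ δ) (bδ δ)) ∧
        ∀ γ : SAW.DomainSAW forcingDomain.carrier δ (aδ δ) (bδ δ),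
          (⟨γ.walk.toCurve (meshPoint δ)⟩ : Curve ℂ).HasTraversals k x ρ R := by
  -- parameters
  set L : ℕ := max (11 * k + 3) ⌈(11 * k + 3) / ε⌉₊ with hLdef
  have hL : 11 * k + 3 ≤ L := le_max_left _ _
  have hLε : (11 * k + 3) / ε ≤ (L : ℝ) := by
    have h1 : (11 * k + 3) / ε ≤ (⌈(11 * k + 3) / ε⌉₊ : ℝ) := Nat.le_ceil _
    have h2 : ((⌈(11 * (k : ℝ) + 3) / ε⌉₊ : ℕ) : ℝ) ≤ (L : ℝ) := by
      rw [hLdef]; exact_mod_cast le_max_right _ _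
    exact h1.trans h2
  have hu0 : 0 < u0 k L := u0_pos
  obtain ⟨n₁, hn₁⟩ := exists_xlev_lt (half_pos hu0)
  have hρ : 0 < ρsh k L := ρ_pos
  refine ⟨xS k L, ρsh k L, Rsh k L, min (dmin n₁) (min (u0 k L / 4) (ρsh k L)),
    lt_min (dmin_pos _) (lt_min (by positivity) hρ),
    (min_le_right _ _).trans (min_le_right _ _), ρ_lt_R hL, R_le_one hL, ratio_lt hL hε hLε, ?_⟩
  intro δ hδ
  obtain ⟨hδ0, hδ1⟩ := hδ
  have hdn1 : δ ≤ dmin n₁ := hδ1.trans (min_le_left _ _)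
  have hd0 : δ ≤ dmin 0 := hdn1.trans (dmin_antitone (Nat.zero_le n₁))
  have hδu : δ ≤ u0 k L / 4 := hδ1.trans ((min_le_right _ _).trans (min_le_left _ _))
  refine ⟨isProbabilityMeasure_law forcingDomain.isBounded hδ0 (reachable_ab hδ0 hd0), fun γ => ?_⟩
  -- the polyline and its abscissa
  set p : C(unitInterval, ℂ) := γ.walk.toCurve (meshPoint δ) with hp
  have hf : Continuous fun s : unitInterval => (p s).re := continuous_re.comp p.continuous
  have hSWc : ∀ s, p s ∈ SWc := fun s =>
    closure_carrier_subset_SWc (range_polyline_subset_closure (aδ_mem_RS hδ0 hd0).1 γ ⟨s, rfl⟩)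
  have hp0 : (p 0).re = δ * icol δ := by
    rw [hp, SimpleGraph.Walk.toCurve_apply_zero]
    simp [aδ]
  have hp1 : (p 1).re = δ * ib δ := by
    rw [hp, toCurve_apply_one]
    simp [bδ]
  have hf0 : (p 0).re < useq k L 0 := by
    rw [hp0]
    have h1 := (icol_bounds hδ0).2
    have h2 := xres_le hδ0 hdn1
    have : useq k L 0 = u0 k L := rfl
    linarith
  have hf1 : ∀ j ≤ 2 * k, useq k L j < (p 1).re := by
    intro j hj
    rw [hp1]
    have h1 := (ib_bounds hδ0).1
    have h2 : useq k L j ≤ utop k L := useq_mono k L hj le_rfl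
    have h3 := utop_le hL
    have h4 := delta_small hδ0 hd0
    linarith
  obtain ⟨t, ht, hlt⟩ := exists_chain hf (useq k L) (2 * k) (fun j hj => useq_lt_succ k L hj) hf0 hf1
  -- common estimates
  have hmonoS : ∀ {j}, j ≤ 2 * k → Real.sqrt (u0 k L) ≤ Real.sqrt (useq k L j) ∧
      Real.sqrt (useq k L j) ≤ Real.sqrt (utop k L) ∧ u0 k L ≤ useq k L j ∧ useq k L j ≤ utop k L := by
    intro j hj
    have h1 : u0 k L ≤ useq k L j := useq_mono k L (Nat.zero_le _) hj
    have h2 : useq k L j ≤ utop k L := useq_mono k L hj le_rfl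
    exact ⟨Real.sqrt_le_sqrt h1, Real.sqrt_le_sqrt h2, h1, h2⟩
  refine ⟨fun i => t (2 * i + 1), fun i => t (2 * i + 2), fun i => ?_, fun i j hij => ?_⟩
  · have hi := i.isLt
    refine ⟨(chain_lt hlt (a := 2 * i + 1) (b := 2 * i + 2) (by omega) (by omega)).le, Or.inl ⟨?_, ?_⟩⟩
    · -- near: bottom turning abscissa
      show dist (p (t (2 * i + 1))) (xS k L) ≤ ρsh k L
      set z := p (t (2 * i + 1)) with hz
      have hre : z.re = useq k L (2 * i + 1) := ht _ (by omega)
      have hc : ctr z.re = -Real.sqrt (useq k L (2 * i + 1)) := by rw [hre]; exact ctr_useq_odd k L i hi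
      obtain ⟨hz1, -⟩ := hSWc (t (2 * i + 1))
      rw [← hz] at hz1
      obtain ⟨m1, m2, m3, m4⟩ := hmonoS (j := 2 * i + 1) (by omega)
      refine (dist_le_abs_re_add_abs_im _ _).trans ?_
      simp only [xS]
      have hA : |z.re - u0 k L| ≤ utop k L - u0 k L := by
        rw [hre, abs_of_nonneg (by linarith)]; linarith
      have hB : |z.im - -Real.sqrt (u0 k L)| ≤ sl * utop k L + (Real.sqrt (utop k L) - Real.sqrt (u0 k L)) := by
        have h1 : |z.im - -Real.sqrt (u0 k L)| ≤ |z.im - ctr z.re| + |ctr z.re + Real.sqrt (u0 k L)| := by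
          have := abs_add_le (z.im - ctr z.re) (ctr z.re + Real.sqrt (u0 k L))
          have heq : z.im - ctr z.re + (ctr z.re + Real.sqrt (u0 k L)) = z.im - -Real.sqrt (u0 k L) := by ring
          rwa [heq] at this
        have h2 : |ctr z.re + Real.sqrt (u0 k L)| = Real.sqrt (useq k L (2 * i + 1)) - Real.sqrt (u0 k L) := by
          rw [hc, abs_of_nonpos (by linarith)]; ring
        have h3 : sl * z.re ≤ sl * utop k L := by rw [hre]; exact mul_le_mul_of_nonneg_left m4 sl_pos.le
        linarith
      unfold ρsh
      linarith
    · -- far: top turning abscissa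
      show Rsh k L ≤ dist (p (t (2 * i + 2))) (xS k L)
      set z := p (t (2 * i + 2)) with hz
      have hre : z.re = useq k L (2 * (i + 1)) := by
        rw [show 2 * ((i : ℕ) + 1) = 2 * i + 2 by ring]; exact ht _ (by omega)
      have hc : ctr z.re = Real.sqrt (useq k L (2 * (i + 1))) := by
        rw [hre]; exact ctr_useq_even k L (i + 1) (by omega)
      obtain ⟨hz1, -⟩ := hSWc (t (2 * i + 2))
      rw [← hz] at hz1
      obtain ⟨m1, m2, m3, m4⟩ := hmonoS (j := 2 * (i + 1)) (by omega)
      refine le_trans ?_ (abs_im_sub_le_dist _ _)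
      simp only [xS]
      have hsl := sl_utop_le_R hL
      have h1 : ctr z.re - sl * z.re ≤ z.im := by
        have := neg_abs_le (z.im - ctr z.re); linarith
      have h3 : sl * z.re ≤ sl * utop k L := by rw [hre]; exact mul_le_mul_of_nonneg_left m4 sl_pos.le
      rw [hc] at h1
      unfold Rsh at hsl ⊢
      have : Real.sqrt (u0 k L) ≤ z.im - -Real.sqrt (u0 k L) := by linarith
      exact this.trans (le_abs_self _)
  · have hi := i.isLt
    have hj := j.isLt
    have hij' : (i : ℕ) < j := hij
    exact chain_lt hlt (a := 2 * i + 2) (b := 2 * j + 1) (by omega) (by omega)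

end Summit.CriticalPhenomena.SAWScalingLimit.Theorems.ShellCrossingBound.Negative.Forcing
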